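import Literature.NumberTheory.Automorphic.UnitaryGroupDualPairCarriers
import HarnessLib

/-!
# The centre `U(1)(𝔸_F) → U(J)(𝔸_F)` of an adelic unitary group and the anti-diagonal centre of a dual pair

[Mok2014, §1 Notation p. 5] identifies the centre of the quasi-split unitary group `U_{E/F}(N)` with
`U_{E/F}(1)`, the norm-one torus `{u | c(u) · u = 1}` of the quadratic extension `E/F`, acting by scalars.  Over
the adèles of `F` this is the subgroup `adelicOne F E c ≤ 𝔸_Eˣ` (`= U(1)(𝔸_F)`) of idèles `u` with `(c ⊗ 1)(u) · u = 1`
(`UnitaryGroup.conjAdele`), embedded as `u ↦ u · 1_N` into `U(J)(𝔸_F) = UnitaryGroup.adelic F E c N J` for EVERY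
form `J` (`UnitaryGroup.scalar_mem_unitaryGroupOfForm`, kernel).  For a dual pair `(U(J_V), U(J_W))` inside the
big unitary group `G₁ = U(J_V ⊗ J_W)` (`UnitaryGroup.adelicPair`, inclusions `adelicInl : g ↦ g ⊗ 1`,
`adelicInr : g′ ↦ 1 ⊗ g′`) the two centres meet along the ANTI-DIAGONAL:
`(u · 1_V) ⊗ 1 · 1 ⊗ (u⁻¹ · 1_W) = (u u⁻¹) · 1 = 1` in `G₁(𝔸_F)` — so any splitting of the pair obtained by
RESTRICTING a homomorphism on `G₁(𝔸_F)` ([GelbartRogawski1991, §3.1 Prop. 3.1.1 p. 455 L1–3]) is trivial on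
`{(u · 1_V, u⁻¹ · 1_W)}`, and the central characters of a dual pair's Weil representation are compared along it.

* `UnitaryGroup.adelicOne F E c` — `U(1)(𝔸_F) = {u ∈ 𝔸_Eˣ | (c ⊗ 1)(u) · u = 1}` in the `adelic` currency
  (`mem_adelicOne_iff`);
* `UnitaryGroup.adelicCenter F E c N J : adelicOne F E c →* adelic F E c N J`, `u ↦ u · 1_N`
  (`coe_adelicCenter`, `adelicCenter_mem_center`, `det_coe_adelicCenter` / `det_adelicCenter`: `det (u · 1_N) = u ^ N`);
* `UnitaryGroup.adelicInl_adelicCenter_mul_adelicInr_adelicCenter_inv` —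
  `a(u · 1_V) · b(u⁻¹ · 1_W) = 1` in `G₁(𝔸_F)` (and the mirror form `a(u⁻¹ · 1_V) · b(u · 1_W) = 1`).

Kernel only; 0 records.  No number-field hypothesis on `F` is used (the carriers are subgroups of
`GL_N(𝔸_E)`); `c` is any `F`-algebra automorphism of `E` (the currency of `UnitaryGroup.adelic`).  NOT here: the
identification of `adelicOne L⁺ L complexConj` with the tree's Galois-norm torus `relNormOneIdeles L⁺ L`
(`RelNormOneTorus`, whose compact quotient `[U(1)]` carries the Haar datum) — a one-line bridge for whoever
integrates over the centre; and the topology / rational points of `adelicOne` (not needed for the algebra below).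
-/

noncomputable section

open scoped Matrix Kronecker
open NumberField

namespace Literature.NumberTheory.Automorphic

namespace UnitaryGroup

section Center

variable (F E : Type) [Field F] [Field E] [NumberField E] [Algebra F E] (c : E ≃ₐ[F] E)

/-- **`U(1)(𝔸_F)`, the norm-one idèles of `E/F`**: `{u ∈ 𝔸_Eˣ | (c ⊗ 1)(u) · u = 1}` — the adelic points of
`U_{E/F}(1)`, the centre of every `U_{E/F}(N)` ([Mok2014, §1]: "we identify the centre of `U_{E/F}(N)` as
`U_{E/F}(1)`"). [cite: Mok2014, §1 Notation p. 5] -/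
def adelicOne : Subgroup (AdeleRing (𝓞 E) E)ˣ where
  carrier := {u | conjAdele F E c (u : AdeleRing (𝓞 E) E) * u = 1}
  one_mem' := by
    show conjAdele F E c ((1 : (AdeleRing (𝓞 E) E)ˣ) : AdeleRing (𝓞 E) E) * _ = 1
    rw [Units.val_one, map_one, one_mul]
  mul_mem' {u v} hu hv := by
    have hu' : conjAdele F E c (u : AdeleRing (𝓞 E) E) * u = 1 := hu
    have hv' : conjAdele F E c (v : AdeleRing (𝓞 E) E) * v = 1 := hv
    show conjAdele F E c ((u * v : (AdeleRing (𝓞 E) E)ˣ) : AdeleRing (𝓞 E) E) * _ = 1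
    rw [Units.val_mul, map_mul, mul_mul_mul_comm, hu', hv', one_mul]
  inv_mem' {u} hu := by
    have hu' : conjAdele F E c (u : AdeleRing (𝓞 E) E) * u = 1 := hu
    show conjAdele F E c ((u⁻¹ : (AdeleRing (𝓞 E) E)ˣ) : AdeleRing (𝓞 E) E) * _ = 1
    have h : conjAdele F E c ((u⁻¹ : (AdeleRing (𝓞 E) E)ˣ) : AdeleRing (𝓞 E) E) *
        ((u⁻¹ : (AdeleRing (𝓞 E) E)ˣ) : AdeleRing (𝓞 E) E) *
          (conjAdele F E c (u : AdeleRing (𝓞 E) E) * u) = 1 := by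
      rw [mul_mul_mul_comm, ← map_mul, Units.inv_mul, map_one, one_mul]
    rwa [hu', mul_one] at h

/-- membership: `(c ⊗ 1)(u) · u = 1`. [cite: Mok2014, §1 Notation p. 5] -/
theorem mem_adelicOne_iff (u : (AdeleRing (𝓞 E) E)ˣ) :
    u ∈ adelicOne F E c ↔ conjAdele F E c (u : AdeleRing (𝓞 E) E) * u = 1 :=
  Iff.rfl

variable (N : ℕ) (J : Matrix (Fin N) (Fin N) E)

/-- **the centre `u ↦ u · 1_N : U(1)(𝔸_F) →* U(J)(𝔸_F)`** (the scalar `u · 1_N` preserves every form `J`: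
`UnitaryGroup.scalar_mem_unitaryGroupOfForm`). [cite: Mok2014, §1 Notation p. 5] -/
def adelicCenter : adelicOne F E c →* adelic F E c N J :=
  MonoidHom.codRestrict
    ((Units.map (Matrix.scalar (Fin N) :
          AdeleRing (𝓞 E) E →+* Matrix (Fin N) (Fin N) (AdeleRing (𝓞 E) E)).toMonoidHom).comp
      (adelicOne F E c).subtype)
    (adelic F E c N J) fun u => scalar_mem_unitaryGroupOfForm _ _ _ u.2

/-- underlying matrix of the central element: the scalar matrix `u · 1_N`. [folklore] -/
@[simp] theorem coe_adelicCenter (u : adelicOne F E c) :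
    (((adelicCenter F E c N J u : adelic F E c N J) : GL (Fin N) (AdeleRing (𝓞 E) E)) :
        Matrix (Fin N) (Fin N) (AdeleRing (𝓞 E) E)) =
      ((u : (AdeleRing (𝓞 E) E)ˣ) : AdeleRing (𝓞 E) E) • (1 : Matrix (Fin N) (Fin N) (AdeleRing (𝓞 E) E)) :=
  (Matrix.smul_one_eq_diagonal _).symm

/-- `u · 1_N` is central in `U(J)(𝔸_F)`. [cite: Mok2014, §1 Notation p. 5] -/
theorem adelicCenter_mem_center (u : adelicOne F E c) :
    adelicCenter F E c N J u ∈ Subgroup.center (adelic F E c N J) := by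
  rw [Subgroup.mem_center_iff]
  intro g
  apply Subtype.ext
  apply Units.ext
  simp only [Subgroup.coe_mul, Units.val_mul, coe_adelicCenter, Matrix.mul_smul, Matrix.smul_mul, Matrix.mul_one,
    Matrix.one_mul]

/-- `(u · 1_N) · g = g · (u · 1_N)`. [folklore] -/
theorem adelicCenter_mul_comm (u : adelicOne F E c) (g : adelic F E c N J) :
    adelicCenter F E c N J u * g = g * adelicCenter F E c N J u :=
  (Subgroup.mem_center_iff.1 (adelicCenter_mem_center F E c N J u) g).symm

/-- `det (u · 1_N) = u ^ N` — for characters `η ∘ det` evaluated on the centre. [folklore] -/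
theorem det_coe_adelicCenter (u : adelicOne F E c) :
    Matrix.det (((adelicCenter F E c N J u : adelic F E c N J) : GL (Fin N) (AdeleRing (𝓞 E) E)) :
        Matrix (Fin N) (Fin N) (AdeleRing (𝓞 E) E)) =
      ((u : (AdeleRing (𝓞 E) E)ˣ) : AdeleRing (𝓞 E) E) ^ N := by
  rw [coe_adelicCenter, Matrix.det_smul, Matrix.det_one, mul_one, Fintype.card_fin]

/-- the same in units: `det (u · 1_N) = u ^ N` in `(𝔸_E)ˣ`. [folklore] -/
theorem det_adelicCenter (u : adelicOne F E c) :
    Matrix.GeneralLinearGroup.det ((adelicCenter F E c N J u : adelic F E c N J) : GL (Fin N) (AdeleRing (𝓞 E) E)) =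
      (u : (AdeleRing (𝓞 E) E)ˣ) ^ N :=
  Units.ext ((det_coe_adelicCenter F E c N J u).trans (Units.val_pow_eq_pow_val _ _).symm)

end Center

section AntiDiagonal

variable (F E : Type) [Field F] [Field E] [NumberField E] [Algebra F E] (c : E ≃ₐ[F] E)
variable (N M : ℕ) (JV : Matrix (Fin N) (Fin N) E) (JW : Matrix (Fin M) (Fin M) E)

/-- **The anti-diagonal centre dies in `G₁(𝔸_F)`**: `(u · 1_V) ⊗ 1 · 1 ⊗ (u⁻¹ · 1_W) = 1` — the element
`(u · 1_V, u⁻¹ · 1_W)` of `U(J_V)(𝔸_F) × U(J_W)(𝔸_F)` maps to the identity of `U(J_V ⊗ J_W)(𝔸_F)`, so every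
splitting of the pair restricted from `G₁(𝔸_F)` is trivial on it. [folklore] -/
theorem adelicInl_adelicCenter_mul_adelicInr_adelicCenter_inv (u : adelicOne F E c) :
    adelicInl F E c N M JV JW (adelicCenter F E c N JV u) * adelicInr F E c N M JV JW (adelicCenter F E c M JW u⁻¹) = 1 := by
  apply Subtype.ext
  apply Units.ext
  simp only [Subgroup.coe_mul, Units.val_mul, coe_adelicInl, coe_adelicInr, coe_adelicCenter, Subgroup.coe_inv,
    Subgroup.coe_one, Units.val_one]
  rw [Matrix.smul_kronecker, Matrix.kronecker_smul, Matrix.one_kronecker_one, Matrix.smul_mul, Matrix.mul_smul,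
    Matrix.one_mul, smul_smul, Units.mul_inv, one_smul]

/-- mirror form: `(u⁻¹ · 1_V) ⊗ 1 · 1 ⊗ (u · 1_W) = 1`. [folklore] -/
theorem adelicInl_adelicCenter_inv_mul_adelicInr_adelicCenter (u : adelicOne F E c) :
    adelicInl F E c N M JV JW (adelicCenter F E c N JV u⁻¹) * adelicInr F E c N M JV JW (adelicCenter F E c M JW u) = 1 := by
  have h := adelicInl_adelicCenter_mul_adelicInr_adelicCenter_inv F E c N M JV JW u⁻¹
  rwa [inv_inv] at h

end AntiDiagonal

end UnitaryGroup

end Literature.NumberTheory.Automorphic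

end
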